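import Summits.NavierStokesRegularity.NavierStokesRegularity.Theorems.CertifiedBlowupCertifiedBlowupVorticityRateBlowupAngularVelocity
import Summits.NavierStokesRegularity.NavierStokesRegularity.Theorems.CertifiedBlowupCertifiedBlowupAxisymBlowupLerayRates
import Summits.NavierStokesRegularity.OSWSelfSimilar.TypeIIInnerLimitDiscriminator
import HarnessLib

/-!
# Certificate class `CertifiedBlowupVorticityRateBlowup` (stmt-NavierStokesRegularity-8639): the velocity gauge at the gauge times —
# the vertex is always at zoomed distance `≥ c_L²` (Leray), and a TYPE-II-MODULATED gauge sequence forces a velocity-dominated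
# (type-(α)) inner object

Theorems file landed `--supports stmt-NavierStokesRegularity-8639` (cell `ns-blowup`, GROUP B zone Z1 «Type-II log-modulated
similarity ansatz» → the certificate crux), fifth crux-side deposit of the zone-Z1 seat. The zone's object is the MODULATION of the
velocity gauge `λ_a(t) = ν/‖u(t)‖_∞` against the self-similar clock `√(ν(T − t))`; at the gauge times `tₖ` of the Z1 zoom
(`(λₖ/ν)‖u‖ ≤ 1` on `[0, tₖ] × ℝ³`) the dimensionless distance of the vertex is `d_k := ν(T − tₖ)/λₖ²`.

* `gauge_vertex_distance_ge_leray` — **`c_L² λₖ² ≤ ν(T − tₖ)` for EVERY gauge time** (`c_L` Leray's absolute constant, the tree's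
  `leray_rates_of_isMaximalSmoothSolution`): Leray's `‖u(tₖ, x)‖ ≥ c_L√ν/√(T − tₖ)` at some `x` against the gauge `‖u(tₖ)‖ ≤ ν/λₖ`.
  The zoom window never reaches the singularity within zoomed time `c_L²`; the modulation is never faster than Type I at a
  gauge time in this one-sided sense;
* `innerObject_curl_eq_zero_of_typeII_gauge` — **under the certificate, a TYPE-II-MODULATED gauge subsequence
  (`d_{φ(k)} → ∞`) forces `curl W ≡ 0`**: (K71)'s Type-I bound `d_{φ(k)} ≤ 2C_ω/‖curl W(s₀)(y₀)‖` along the extracted subsequence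
  is incompatible with `d_{φ(k)} → ∞` unless every `curl W(s₀)(y₀)` vanishes; hence (`knssBlowupLimit_const_of_curl_eq_zero`)
  every slice of the inner object is CONSTANT — the inner object is velocity-dominated, type (α);
* `vorticityRate_witness_gaugeModulation_alternative` — assembled for every certificate-class witness: `c_L² λₖ² ≤ ν(T − tₖ)`
  for all `k`, and EITHER the extracted gauge subsequence is Type-I-modulated in the two-sided sense
  (`c_L² ≤ d_{φ(k)}` always, `d_{φ(k)} ≤ K` eventually, some `K`) OR the inner object is constant on every slice (type (α)).

ZONE-Z1 READING: for the certificate class the dichotomy «(α) velocity-dominated core / (β) swirling core» is ALIGNED with the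
modulation law of the velocity gauge along the zoom: (β) ⇒ Type-I modulation `λ_a(t_{φ(k)}) ≍ √(ν(T − t_{φ(k)}))` (constants
`[c_L², K]`); a genuinely Type-II (e.g. log-)modulated gauge subsequence ⇒ (α). Nothing here asserts that either occurs.
No new definitions, no named-fact hypotheses, no `sorry`. WHAT THIS IS NOT: not a blow-up or regularity claim and no word on
(AX-L). Author: ns-blowup-profile-eng-1 g10, 2026-08-27.

## References
* J. Leray, Acta Math. 63 (1934), §19 (3.9). [Leray1934]
* G. Koch, N. Nadirashvili, G. Seregin, V. Šverák, Acta Math. 203 (2009), §6. [KochNadirashviliSereginSverak2009]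
-/

-- the summit and its single problem share the name (D-0017 nested layout)
set_option linter.dupNamespace false

open MeasureTheory Set Function Filter Topology Metric
open scoped ENNReal NNReal

namespace Summit.NavierStokesRegularity.NavierStokesRegularity.Theorems.CertifiedBlowupVorticityRateBlowup.InnerObject

open Literature.Analysis.FluidPDE
open Summit.NavierStokesRegularity.OSWSelfSimilar.TypeIIModulationDictionary
open Summit.NavierStokesRegularity.NavierStokesRegularity.Theorems.CertifiedBlowupAxisymBlowup.CompactAmplification

section Gauge

variable {ν T C c : ℝ} {u : ℝ → EuclideanSpace ℝ (Fin 3) → EuclideanSpace ℝ (Fin 3)}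
  {tn lamn : ℕ → ℝ} {cn : ℕ → EuclideanSpace ℝ (Fin 3)} {φ : ℕ → ℕ}
  {W : ℝ → EuclideanSpace ℝ (Fin 3) → EuclideanSpace ℝ (Fin 3)}

/-- **The vertex is at zoomed distance `≥ c²` from every gauge time.** If `tₖ ∈ [T/2, T)`, `0 < λₖ`, `(λₖ/ν)‖u(t, x)‖ ≤ 1` on
`[0, tₖ] × ℝ³`, and a Leray lower rate `‖u(t, x_t)‖ ≥ c√ν/√(T − t)` holds at some point for every `t ∈ [0, T)` (`0 < c`), then
`c² λₖ² ≤ ν(T − tₖ)` for every `k`. [cite: Leray1934, §19 (3.9)] -/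
theorem gauge_vertex_distance_ge_leray (hν : 0 < ν) (hT : 0 < T) (htn : ∀ k, T / 2 ≤ tn k ∧ tn k < T)
    (hlam : ∀ k, 0 < lamn k) (hgauge : ∀ k, ∀ t ∈ Icc 0 (tn k), ∀ x, lamn k / ν * ‖u t x‖ ≤ 1) (hc : 0 < c)
    (hler : ∀ t ∈ Ico 0 T, ∃ x, c * Real.sqrt ν / Real.sqrt (T - t) ≤ ‖u t x‖) (k : ℕ) :
    c ^ 2 * lamn k ^ 2 ≤ ν * (T - tn k) := by
  have htk : tn k ∈ Ico 0 T := ⟨by linarith [(htn k).1], (htn k).2⟩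
  have hTt : 0 < T - tn k := sub_pos.2 (htn k).2
  obtain ⟨x, hx⟩ := hler _ htk
  have hg := hgauge k (tn k) ⟨htk.1, le_rfl⟩ x
  -- `(λₖ/ν)·(c√ν/√(T−tₖ)) ≤ 1`
  have hl : 0 < lamn k := hlam k
  have h1 : lamn k / ν * (c * Real.sqrt ν / Real.sqrt (T - tn k)) ≤ 1 :=
    (mul_le_mul_of_nonneg_left hx (div_nonneg hl.le hν.le)).trans hg
  have hsq : 0 < Real.sqrt (T - tn k) := Real.sqrt_pos.2 hTt
  have hsν : 0 < Real.sqrt ν := Real.sqrt_pos.2 hν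
  -- clear denominators: `λₖ c √ν ≤ ν √(T − tₖ)`, then square
  have h2 : lamn k * c * Real.sqrt ν ≤ ν * Real.sqrt (T - tn k) := by
    have := h1
    rw [div_mul_div_comm, div_le_one (mul_pos hν hsq)] at this
    linarith
  have h3 : (lamn k * c * Real.sqrt ν) ^ 2 ≤ (ν * Real.sqrt (T - tn k)) ^ 2 :=
    pow_le_pow_left₀ (mul_nonneg (mul_nonneg hl.le hc.le) hsν.le) h2 2
  rw [mul_pow, mul_pow, mul_pow, Real.sq_sqrt hν.le, Real.sq_sqrt hTt.le] at h3
  -- `λ² c² ν ≤ ν² (T − tₖ)` ⇒ divide by `ν`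
  have h4 : ν * (c ^ 2 * lamn k ^ 2) ≤ ν * (ν * (T - tn k)) := by nlinarith
  exact le_of_mul_le_mul_left h4 hν

/-- **A Type-II-modulated gauge subsequence forces an irrotational inner object** (certificate class). With the Z1 gauge data, the
rate `(T − t)‖ω(t)‖_∞ ≤ C` near `T⁻` and the zoomed vorticity converging to `curl W`: if the dimensionless vertex distance diverges
along the extracted subsequence, `ν(T − t_{φ(k)})/λ_{φ(k)}² → ∞`, then `curl W(s)(y) = 0` for all `s < 0`, `y` — (K71)'s bound
`ν(T − t_{φ(k)}) ≤ (2C/‖curl W(s₀)(y₀)‖)λ_{φ(k)}²` for large `k` is incompatible with divergence wherever the curl is non-zero.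
[cite: KochNadirashviliSereginSverak2009, §6 (zoom bookkeeping)] -/
theorem innerObject_curl_eq_zero_of_typeII_gauge (hν : 0 < ν) (htn : ∀ k, T / 2 ≤ tn k ∧ tn k < T)
    (htT : Tendsto tn atTop (𝓝 T)) (hlam : ∀ k, 0 < lamn k) (hlam0 : Tendsto lamn atTop (𝓝 0)) (hφ : StrictMono φ)
    (hgauge : ∀ k, ∀ t ∈ Icc 0 (tn k), ∀ x, lamn k / ν * ‖u t x‖ ≤ 1)
    (hrate : ∀ᶠ t in 𝓝[<] T, ∀ x, (T - t) * ‖curl (u t) x‖ ≤ C)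
    (hcurl : ∀ s < 0, ∀ y : EuclideanSpace ℝ (Fin 3), Tendsto (fun j => (lamn (φ j) ^ 2 / ν) •
      curl (u (tn (φ j) + lamn (φ j) ^ 2 / ν * s)) (cn (φ j) + lamn (φ j) • y)) atTop (𝓝 (curl (W s) y)))
    (hII : Tendsto (fun j => ν * (T - tn (φ j)) / lamn (φ j) ^ 2) atTop atTop) :
    ∀ s < 0, ∀ y : EuclideanSpace ℝ (Fin 3), curl (W s) y = 0 := by
  intro s hs y
  by_contra hne
  obtain ⟨h1, -⟩ := vorticityRate_typeI_along_gauge_of_curl_ne_zero hν htn htT hlam hlam0 hφ hgauge hrate hcurl hs hne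
  set K : ℝ := 2 * C / ‖curl (W s) y‖
  have hbig : ∀ᶠ j in atTop, K + 1 ≤ ν * (T - tn (φ j)) / lamn (φ j) ^ 2 := hII.eventually (eventually_ge_atTop _)
  obtain ⟨j, hj1, hj2⟩ := (h1.and hbig).exists
  have hl : 0 < lamn (φ j) ^ 2 := pow_pos (hlam _) 2
  have : ν * (T - tn (φ j)) / lamn (φ j) ^ 2 ≤ K := by rw [div_le_iff₀ hl]; exact hj1
  linarith

/-- **Hence a Type-II-modulated gauge subsequence forces a velocity-dominated (type-(α)) inner object**: every slice of `W` is
constant in space (`knssBlowupLimit_const_of_curl_eq_zero`: irrotational + incompressible + bounded ⇒ constant).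
[cite: KochNadirashviliSereginSverak2009, §6 (zoom bookkeeping)] -/
theorem innerObject_const_of_typeII_gauge (hν : 0 < ν) (htn : ∀ k, T / 2 ≤ tn k ∧ tn k < T)
    (htT : Tendsto tn atTop (𝓝 T)) (hlam : ∀ k, 0 < lamn k) (hlam0 : Tendsto lamn atTop (𝓝 0)) (hφ : StrictMono φ)
    (hgauge : ∀ k, ∀ t ∈ Icc 0 (tn k), ∀ x, lamn k / ν * ‖u t x‖ ≤ 1)
    (hrate : ∀ᶠ t in 𝓝[<] T, ∀ x, (T - t) * ‖curl (u t) x‖ ≤ C)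
    (hcurl : ∀ s < 0, ∀ y : EuclideanSpace ℝ (Fin 3), Tendsto (fun j => (lamn (φ j) ^ 2 / ν) •
      curl (u (tn (φ j) + lamn (φ j) ^ 2 / ν * s)) (cn (φ j) + lamn (φ j) • y)) atTop (𝓝 (curl (W s) y)))
    (hW : IsKNSSBlowupLimit W) (hII : Tendsto (fun j => ν * (T - tn (φ j)) / lamn (φ j) ^ 2) atTop atTop) :
    ∀ s < 0, ∀ y : EuclideanSpace ℝ (Fin 3), W s y = W s 0 :=
  knssBlowupLimit_const_of_curl_eq_zero hW
    (innerObject_curl_eq_zero_of_typeII_gauge hν htn htT hlam hlam0 hφ hgauge hrate hcurl hII)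

end Gauge

section Assembled

variable {ν T : ℝ} {u : ℝ → EuclideanSpace ℝ (Fin 3) → EuclideanSpace ℝ (Fin 3)}
  {p : ℝ → EuclideanSpace ℝ (Fin 3) → ℝ}

/-- **CERTIFICATE-CLASS WITNESSES: THE MODULATION OF THE VELOCITY GAUGE ALONG THE ZOOM.** For every `(ν, T, u, p)` of the
certificate class: Leray's absolute `c_L > 0`, the Z1 gauge data and inner object `W`, with (i) `c_L² λₖ² ≤ ν(T − tₖ)` for EVERY
`k` (the vertex is at zoomed distance `≥ c_L²`), and (ii) EITHER the extracted gauge subsequence is TYPE-I-MODULATED in the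
two-sided sense — some `K` with `ν(T − t_{φ(k)}) ≤ K λ_{φ(k)}²` for all large `k` (and `≥ c_L² λ_{φ(k)}²` always) — OR the inner
object is constant on every slice (type (α), velocity-dominated core). [cite: Leray1934, §19 (3.9)] -/
theorem vorticityRate_witness_gaugeModulation_alternative (hν : 0 < ν) (hT : 0 < T)
    (hmax : IsMaximalSmoothSolution ν 0 u p T) (hLH : IsLerayHopfOn T ν 0 (u 0) u)
    (hdec : HasRapidSpatialDecay (u 0)) (haxi : IsAxisymmetric (u 0))
    (hrate : ∃ C : ℝ, ∀ᶠ t in 𝓝[<] T, ∀ x : EuclideanSpace ℝ (Fin 3), (T - t) * ‖curl (u t) x‖ ≤ C) :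
    ∃ (cL : ℝ) (tn lamn : ℕ → ℝ) (cn : ℕ → EuclideanSpace ℝ (Fin 3)) (φ : ℕ → ℕ)
      (W : ℝ → EuclideanSpace ℝ (Fin 3) → EuclideanSpace ℝ (Fin 3)),
      0 < cL ∧ (∀ k, T / 2 ≤ tn k ∧ tn k < T) ∧ Tendsto tn atTop (𝓝 T) ∧ (∀ k, 0 < lamn k) ∧ Tendsto lamn atTop (𝓝 0) ∧
      (∀ k, ∀ t ∈ Icc 0 (tn k), ∀ x, lamn k / ν * ‖u t x‖ ≤ 1) ∧ StrictMono φ ∧ IsKNSSBlowupLimit W ∧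
      (∀ s < 0, TendstoLocallyUniformly
        (fun k => ((lamn (φ k) / ν) • stPull (lamn (φ k) ^ 2 / ν) (lamn (φ k)) (tn (φ k)) (cn (φ k)) u) s)
          (W s) atTop) ∧
      (∀ k, cL ^ 2 * lamn k ^ 2 ≤ ν * (T - tn k)) ∧
      ((∃ K : ℝ, ∀ᶠ j in atTop, ν * (T - tn (φ j)) ≤ K * lamn (φ j) ^ 2) ∨
        ∀ s < 0, ∀ y : EuclideanSpace ℝ (Fin 3), W s y = W s 0) := by
  obtain ⟨C, hC⟩ := hrate
  obtain ⟨Mₛ, hMₛ⟩ := hdec.abs_swirl_le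
  obtain ⟨⟨cL, hcL, hler⟩, -⟩ := leray_rates_of_isMaximalSmoothSolution
  have hler' : ∀ t ∈ Ico 0 T, ∃ x, cL * Real.sqrt ν / Real.sqrt (T - t) ≤ ‖u t x‖ :=
    fun t ht => (hler hν hT hmax hLH hdec haxi t ht).2
  obtain ⟨tn, lamn, cn, xn, φ, W, htn, htT, hlam, hlam0, hgauge, -, -, -, -, -, -, hφ, hW, hconv, -, hcurl, halt⟩ :=
    innerObject_master_of_datum hν hT hmax hLH hdec haxi hMₛ
  refine ⟨cL, tn, lamn, cn, φ, W, hcL, htn, htT, hlam, hlam0, hgauge, hφ, hW, hconv,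
    fun k => gauge_vertex_distance_ge_leray hν hT htn hlam hgauge hcL hler' k, ?_⟩
  rcases halt with ⟨⟨c, -, -, hWc⟩, -⟩ | ⟨-, -, -, -, -, ⟨s₀, hs₀, y₀, hne⟩, -⟩
  · exact Or.inr fun s hs y => by rw [hWc s hs y, hWc s hs 0]
  · obtain ⟨h1, -⟩ := vorticityRate_typeI_along_gauge_of_curl_ne_zero hν htn htT hlam hlam0 hφ hgauge hC hcurl hs₀ hne
    exact Or.inl ⟨2 * C / ‖curl (W s₀) y₀‖, h1⟩

end Assembled

end Summit.NavierStokesRegularity.NavierStokesRegularity.Theorems.CertifiedBlowupVorticityRateBlowup.InnerObject
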